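import Summits.AtomisticToContinuum.Crystallization.Theorems.FrustratedLawDichotomyFiniteClusterGapPrelude
import Summits.AtomisticToContinuum.Crystallization.Theorems.PalmUnimodularRigidityBenjaminiSchrammLimitEmbedding

/-!
# FrustratedLawDichotomy · crux `AperiodicFrustratedLawGap` (stmt-AtomisticToContinuum-27623) — LAW-LEVEL DOUBLING, part 1:
# the doubled law of a point-stationary hard-core law with a forbidden difference shell is point-stationary and hard-core
# (decomp-a2c, prover hand 2, structural share; towards the settled class `K_w` = "no pair of atoms at offset `-w` within distance 2")

For a vector `w` and a rooted configuration `μ`, the DOUBLED configuration is `D_w μ = μ + μ.map (· + w)` (the configuration together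
with its translate by `w`, rooted at the old root).  For a law `P` the doubled law is the symmetrised image `P ∘ D_w⁻¹ + P ∘ D_{-w}⁻¹`:
re-rooting a doubled configuration at a point of the copy is the `(-w)`-doubling of the re-rooted original
(`θ_{y+w} D_w = D_{-w} θ_y`, `map_sub_add_add_map_add`), and at a point of the original it is `θ_y D_w = D_w θ_y` (`map_sub_add_map_add`).

* `isRootedHardCore_add_map_add` — on `K_w = {∀ atoms s s', 2 ≤ ‖s − s' + w‖}` the doubled configuration of a rooted `δ`-hard-core
  configuration is a rooted `min δ 2`-hard-core configuration;
* `isPointStationaryLaw_doubled` — **the doubled law of a point-stationary law almost surely carried by rooted hard-core configurations in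
  `K_w` is point-stationary**: its Mecke identity is the sum of FOUR Mecke identities for `P` (payloads `g(D_{±w} μ, y)` and
  `g(D_{±w} μ, y ± w)`).  Campbell functionals are a.e.-measurable through the truncated identity kernel of the prelude and the Giry
  measurability of the hard-core class (`BenjaminiSchrammLimit.measurableSet_setOf_isRootedHardCore`).

Part 2 (energy: `E[h]` of the doubled law is `E_P[h] + E_P[cross terms] < E_P[h]`, hence — with the floor of item 9229 — `e⋆ < E_P[h]` on
`K_w`, a SETTLED CLASS for the generic cut `aperiodicFrustratedLawGap_cut`; thin slabs lie in `⋃_{j,t} K_{t e_j}`) is the sequel.  All `[folklore]`.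
-/

noncomputable section

namespace Summit.AtomisticToContinuum.Crystallization.Theorems.FrustratedLawDichotomyFiniteClusterGap

open MeasureTheory Metric Set Filter ProbabilityTheory
open scoped ENNReal Topology BigOperators
open Literature.MathematicalPhysics.StatisticalMechanics Literature.Probability.Process
open Summit.AtomisticToContinuum.Crystallization.Theorems.ChargedEnergyGapNegative (E3 eStar)
open Summit.AtomisticToContinuum.Crystallization.Theorems.BenjaminiSchrammLimit (measurableSet_setOf_isRootedHardCore)

section Doubling

variable {δ : ℝ} {P : Measure (Measure E3)}

/-! ### The doubling map -/

/-- `μ ↦ μ + μ.map (· + w)` is measurable (Giry σ-algebra). [folklore] -/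
theorem measurable_add_map_add (w : E3) : Measurable fun μ : Measure E3 => μ + μ.map (fun z => z + w) := by
  refine Measure.measurable_of_measurable_coe _ fun s hs => ?_
  have : (fun μ : Measure E3 => (μ + μ.map (fun z => z + w)) s) = fun μ => μ s + μ ((fun z => z + w) ⁻¹' s) := by
    funext μ
    rw [Measure.add_apply, Measure.map_apply (measurable_add_const w) hs]
  rw [this]
  exact (Measure.measurable_coe hs).add (Measure.measurable_coe ((measurable_add_const w) hs))

/-- Re-rooting a doubled configuration at a point of the original: `θ_y (D_w μ) = D_w (θ_y μ)`. [folklore] -/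
theorem map_sub_add_map_add (μ : Measure E3) (w y : E3) :
    (μ + μ.map (fun z => z + w)).map (fun z => z - y) =
      μ.map (fun z => z - y) + (μ.map (fun z => z - y)).map (fun z => z + w) := by
  rw [Measure.map_add _ _ (measurable_sub_const y), Measure.map_map (measurable_sub_const y) (measurable_add_const w),
    Measure.map_map (measurable_add_const w) (measurable_sub_const y)]
  have hcomp : ((fun z : E3 => z - y) ∘ fun z => z + w) = ((fun z : E3 => z + w) ∘ fun z => z - y) := by
    funext z; simp only [Function.comp_apply]; abel
  rw [hcomp]

/-- Re-rooting a doubled configuration at a point of the copy: `θ_{y+w} (D_w μ) = D_{-w} (θ_y μ)`. [folklore] -/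
theorem map_sub_add_add_map_add (μ : Measure E3) (w y : E3) :
    (μ + μ.map (fun z => z + w)).map (fun z => z - (y + w)) =
      μ.map (fun z => z - y) + (μ.map (fun z => z - y)).map (fun z => z + -w) := by
  rw [Measure.map_add _ _ (measurable_sub_const _), Measure.map_map (measurable_sub_const _) (measurable_add_const w),
    Measure.map_map (measurable_add_const (-w)) (measurable_sub_const y)]
  have h1 : ((fun z : E3 => z - (y + w)) ∘ fun z => z + w) = fun z => z - y := by
    funext z; simp only [Function.comp_apply]; abel
  have h2 : ((fun z : E3 => z + -w) ∘ fun z => z - y) = fun z => z - (y + w) := by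
    funext z; simp only [Function.comp_apply]; abel
  rw [h1, h2]
  exact add_comm _ _

/-- The translate of a counting measure: `(count|S).map (· + w) = count|((· + w) '' S)`. [folklore] -/
theorem map_add_count_restrict (S : Set E3) (w : E3) :
    ((Measure.count : Measure E3).restrict S).map (fun z => z + w) = (Measure.count : Measure E3).restrict ((fun z => z + w) '' S) := by
  have h := map_sub_count_restrict S (-w)
  simp only [sub_neg_eq_add] at h
  exact h

/-- **Doubling preserves the hard core on `K_w`.**  If `μ` is a rooted `δ`-hard-core configuration (`δ > 0`) all of whose atoms `s, s'`
satisfy `2 ≤ ‖s − s' + w‖`, then `μ + μ.map (· + w)` is a rooted `min δ 2`-hard-core configuration. [folklore] -/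
theorem isRootedHardCore_add_map_add (hδ : 0 < δ) {μ : Measure E3} (hμ : IsRootedHardCore δ μ) {w : E3}
    (hK : ∀ s s' : E3, μ {s} ≠ 0 → μ {s'} ≠ 0 → 2 ≤ ‖s - s' + w‖) :
    IsRootedHardCore (min δ 2) (μ + μ.map (fun z => z + w)) := by
  obtain ⟨S, h0, hsep, rfl⟩ := hμ
  have hK' : ∀ s ∈ S, ∀ s' ∈ S, 2 ≤ ‖s - s' + w‖ := fun s hs s' hs' =>
    hK s s' ((count_restrict_singleton_ne_zero_iff S s).2 hs) ((count_restrict_singleton_ne_zero_iff S s').2 hs')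
  -- the copy is far from the original
  have hcross : ∀ s ∈ S, ∀ s' ∈ S, 2 ≤ dist s (s' + w) := fun s hs s' hs' => by
    rw [dist_eq_norm, show s - (s' + w) = -(s' - s + w) by abel, norm_neg]
    exact hK' s' hs' s hs
  have hdisj : Disjoint S ((fun z => z + w) '' S) := by
    refine Set.disjoint_left.2 fun s hs hs' => ?_
    obtain ⟨s', hs'S, rfl⟩ := hs'
    have := hcross (s' + w) hs s' hs'S
    rw [dist_self] at this
    norm_num at this
  have hSm : MeasurableSet ((fun z : E3 => z + w) '' S) := by
    have : (fun z : E3 => z + w) '' S = (fun z : E3 => z - w) ⁻¹' S := by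
      ext z
      constructor
      · rintro ⟨s, hs, rfl⟩
        simpa using hs
      · intro hz
        exact ⟨z - w, hz, by abel⟩
    rw [this]
    exact (measurable_sub_const w) (Metric.isClosed_of_pairwise_le_dist hδ hsep).measurableSet
  refine ⟨S ∪ (fun z => z + w) '' S, Or.inl h0, ?_, ?_⟩
  · rintro x (hx | ⟨s, hs, rfl⟩) y (hy | ⟨s', hs', rfl⟩) hxy
    · exact (min_le_left _ _).trans (hsep x hx y hy hxy)
    · exact (min_le_right _ _).trans (hcross x hx s' hs')
    · rw [dist_comm]; exact (min_le_right _ _).trans (hcross y hy s hs)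
    · rw [dist_add_right]
      exact (min_le_left _ _).trans (hsep s hs s' hs' fun h => hxy (by rw [h]))
  · rw [map_add_count_restrict, Measure.restrict_union hdisj hSm]

/-! ### Campbell functionals are a.e.-measurable on hard-core laws -/

/-- For a law almost surely carried by rooted `δ`-hard-core configurations and a jointly measurable payload `G`, the Campbell functional
`ν ↦ ∫ G(ν, y) dν(y)` is a.e.-measurable (it agrees a.e. with its kernelised, measurable version). [folklore] -/
theorem aemeasurable_lintegral_of_ae_hardCore (hδ : 0 < δ) {Q : Measure (Measure E3)} (hQ : ∀ᵐ ν ∂Q, IsRootedHardCore δ ν)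
    {G : Measure E3 → E3 → ℝ≥0∞} (hG : Measurable (Function.uncurry G)) :
    AEMeasurable (fun ν => ∫⁻ y, G ν y ∂ν) Q := by
  obtain ⟨κ, hκs, hκ⟩ := exists_kernel_eq_count_restrict hδ
  refine ⟨fun ν => ∫⁻ y, G ν y ∂(κ ν), hG.lintegral_kernel_prod_right, ?_⟩
  filter_upwards [hQ] with ν hν
  obtain ⟨S, -, hsep, rfl⟩ := hν
  rw [hκ S hsep]

/-- Same for the re-rooted payload `ν ↦ ∫ G(θ_y ν, -y) dν(y)`. [folklore] -/
theorem aemeasurable_lintegral_reroot_of_ae_hardCore (hδ : 0 < δ) {Q : Measure (Measure E3)} (hQ : ∀ᵐ ν ∂Q, IsRootedHardCore δ ν)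
    {G : Measure E3 → E3 → ℝ≥0∞} (hG : Measurable (Function.uncurry G)) :
    AEMeasurable (fun ν => ∫⁻ y, G (ν.map fun z => z - y) (-y) ∂ν) Q := by
  obtain ⟨κ, hκs, hκ⟩ := exists_kernel_eq_count_restrict hδ
  have hm : Measurable (Function.uncurry fun (ν : Measure E3) (y : E3) => G ((κ ν).map fun z => z - y) (-y)) :=
    hG.comp ((measurable_kernel_map_sub κ).prodMk measurable_snd.neg)
  refine ⟨fun ν => ∫⁻ y, G ((κ ν).map fun z => z - y) (-y) ∂(κ ν), hm.lintegral_kernel_prod_right, ?_⟩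
  filter_upwards [hQ] with ν hν
  obtain ⟨S, -, hsep, rfl⟩ := hν
  rw [hκ S hsep]

/-- For a FIXED rooted hard-core configuration `ν`, `y ↦ G(θ_y ν, -y)` is measurable. [folklore] -/
theorem measurable_reroot_section (hδ : 0 < δ) {ν : Measure E3} (hν : IsRootedHardCore δ ν)
    {G : Measure E3 → E3 → ℝ≥0∞} (hG : Measurable (Function.uncurry G)) :
    Measurable fun y : E3 => G (ν.map fun z => z - y) (-y) := by
  obtain ⟨κ, hκs, hκ⟩ := exists_kernel_eq_count_restrict hδ
  obtain ⟨S, -, hsep, rfl⟩ := hν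
  have hm : Measurable (Function.uncurry fun (ν : Measure E3) (y : E3) => G ((κ ν).map fun z => z - y) (-y)) :=
    hG.comp ((measurable_kernel_map_sub κ).prodMk measurable_snd.neg)
  have h : Measurable fun y : E3 => G ((κ ((Measure.count : Measure E3).restrict S)).map fun z => z - y) (-y) :=
    hm.comp measurable_prodMk_left
  rw [hκ S hsep] at h
  exact h

/-! ### The doubled law is point-stationary -/

/-- **The doubled law is point-stationary.**  Let `P` be point-stationary and almost surely carried by rooted `δ`-hard-core configurations
all of whose atoms satisfy `2 ≤ ‖s − s' + w‖`.  Then `P ∘ D_w⁻¹ + P ∘ D_{-w}⁻¹`, `D_{±w} μ = μ + μ.map (· ± w)`, is point-stationary.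
[folklore] -/
theorem isPointStationaryLaw_doubled (hδ : 0 < δ) (hcore : ∀ᵐ μ ∂P, IsRootedHardCore δ μ) (hstat : IsPointStationaryLaw P) (w : E3)
    (hK : ∀ᵐ μ ∂P, ∀ s s' : E3, μ {s} ≠ 0 → μ {s'} ≠ 0 → 2 ≤ ‖s - s' + w‖) :
    IsPointStationaryLaw (P.map (fun μ : Measure E3 => μ + μ.map (fun z => z + w)) +
      P.map (fun μ : Measure E3 => μ + μ.map (fun z => z + -w))) := by
  intro g hg
  have hδ' : 0 < min δ 2 := lt_min hδ two_pos
  -- the class is symmetric under `w ↦ -w`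
  have hKm : ∀ᵐ μ ∂P, ∀ s s' : E3, μ {s} ≠ 0 → μ {s'} ≠ 0 → 2 ≤ ‖s - s' + -w‖ := by
    filter_upwards [hK] with μ hμ s s' hs hs'
    rw [show s - s' + -w = -(s' - s + w) by abel, norm_neg]
    exact hμ s' s hs' hs
  -- hard core of the doubled configurations
  have hHC : ∀ u : E3, (∀ᵐ μ ∂P, ∀ s s' : E3, μ {s} ≠ 0 → μ {s'} ≠ 0 → 2 ≤ ‖s - s' + u‖) →
      ∀ᵐ μ ∂P, IsRootedHardCore (min δ 2) (μ + μ.map (fun z => z + u)) := fun u hu => by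
    filter_upwards [hcore, hu] with μ hμ hμu
    exact isRootedHardCore_add_map_add hδ hμ hμu
  have hHCmap : ∀ u : E3, (∀ᵐ μ ∂P, ∀ s s' : E3, μ {s} ≠ 0 → μ {s'} ≠ 0 → 2 ≤ ‖s - s' + u‖) →
      ∀ᵐ ν ∂(P.map (fun μ : Measure E3 => μ + μ.map (fun z => z + u))), IsRootedHardCore (min δ 2) ν := fun u hu =>
    (ae_map_iff (measurable_add_map_add u).aemeasurable (measurableSet_setOf_isRootedHardCore hδ')).2 (hHC u hu)
  -- the two Campbell functionals of the Mecke identity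
  set Φ : Measure E3 → ℝ≥0∞ := fun ν => ∫⁻ y, g ν y ∂ν with hΦ
  set Ψ : Measure E3 → ℝ≥0∞ := fun ν => ∫⁻ y, g (ν.map fun z => z - y) (-y) ∂ν with hΨ
  -- evaluation of both along one doubling map: two Mecke identities for `P` each
  have hside : ∀ u : E3, (∀ᵐ μ ∂P, ∀ s s' : E3, μ {s} ≠ 0 → μ {s'} ≠ 0 → 2 ≤ ‖s - s' + u‖) →
      (∫⁻ ν, Φ ν ∂(P.map (fun μ : Measure E3 => μ + μ.map (fun z => z + u))) =
        ∫⁻ μ, ∫⁻ y, g (μ.map (fun z => z - y) + (μ.map (fun z => z - y)).map (fun z => z + u)) (-y) ∂μ ∂P +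
        ∫⁻ μ, ∫⁻ y, g (μ.map (fun z => z - y) + (μ.map (fun z => z - y)).map (fun z => z + u)) (-y + u) ∂μ ∂P) ∧
      (∫⁻ ν, Ψ ν ∂(P.map (fun μ : Measure E3 => μ + μ.map (fun z => z + u))) =
        ∫⁻ μ, ∫⁻ y, g (μ.map (fun z => z - y) + (μ.map (fun z => z - y)).map (fun z => z + u)) (-y) ∂μ ∂P +
        ∫⁻ μ, ∫⁻ y, g (μ.map (fun z => z - y) + (μ.map (fun z => z - y)).map (fun z => z + -u)) (-y + -u) ∂μ ∂P) := by
    intro u hu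
    have hDm : Measurable fun μ : Measure E3 => μ + μ.map (fun z => z + u) := measurable_add_map_add u
    -- payloads for the Mecke identity of `P`
    have hG₁ : Measurable (Function.uncurry fun (μ : Measure E3) (y : E3) => g (μ + μ.map (fun z => z + u)) y) :=
      hg.comp ((hDm.comp measurable_fst).prodMk measurable_snd)
    have hG₂ : Measurable (Function.uncurry fun (μ : Measure E3) (y : E3) => g (μ + μ.map (fun z => z + u)) (y + u)) :=
      hg.comp ((hDm.comp measurable_fst).prodMk (measurable_snd.add_const u))
    constructor
    · -- `Φ ∘ D_u = ∫ G₁ dμ + ∫ G₂ dμ`, then Mecke for `G₁`, `G₂`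
      rw [lintegral_map' (aemeasurable_lintegral_of_ae_hardCore hδ' (hHCmap u hu) hg) hDm.aemeasurable]
      have hsplit : (fun μ : Measure E3 => Φ (μ + μ.map (fun z => z + u))) = fun μ =>
          ∫⁻ y, g (μ + μ.map (fun z => z + u)) y ∂μ + ∫⁻ y, g (μ + μ.map (fun z => z + u)) (y + u) ∂μ := by
        funext μ
        have hsec : Measurable (fun y : E3 => g (μ + μ.map (fun z => z + u)) y) := hg.comp measurable_prodMk_left
        simp only [hΦ]
        rw [lintegral_add_measure, lintegral_map hsec (measurable_add_const u)]
      show ∫⁻ μ, Φ (μ + μ.map (fun z => z + u)) ∂P = _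
      rw [hsplit, lintegral_add_left' (aemeasurable_lintegral_of_ae_hardCore hδ hcore hG₁), hstat _ hG₁, hstat _ hG₂]
    · -- `Ψ ∘ D_u`: split the doubled measure, re-root inside (`θ_y D_u = D_u θ_y`, `θ_{y+u} D_u = D_{-u} θ_y`)
      rw [lintegral_map' (aemeasurable_lintegral_reroot_of_ae_hardCore hδ' (hHCmap u hu) hg) hDm.aemeasurable]
      have hsplit : ∀ᵐ μ ∂P, Ψ (μ + μ.map (fun z => z + u)) =
          ∫⁻ y, g (μ.map (fun z => z - y) + (μ.map (fun z => z - y)).map (fun z => z + u)) (-y) ∂μ +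
          ∫⁻ y, g (μ.map (fun z => z - y) + (μ.map (fun z => z - y)).map (fun z => z + -u)) (-(y + u)) ∂μ := by
        filter_upwards [hHC u hu] with μ hμ
        simp only [hΨ]
        rw [lintegral_add_measure, lintegral_map (measurable_reroot_section hδ' hμ hg) (measurable_add_const u)]
        simp only [map_sub_add_add_map_add]
        simp only [map_sub_add_map_add]
      show ∫⁻ μ, Ψ (μ + μ.map (fun z => z + u)) ∂P = _
      rw [lintegral_congr_ae hsplit]
      -- the first summand is the Mecke right-hand side for the payload `G₁`: a.e.-measurable
      have hA : AEMeasurable (fun μ : Measure E3 =>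
          ∫⁻ y, g (μ.map (fun z => z - y) + (μ.map (fun z => z - y)).map (fun z => z + u)) (-y) ∂μ) P := by
        have := aemeasurable_lintegral_reroot_of_ae_hardCore hδ hcore hG₁
        exact this
      rw [lintegral_add_left' hA]
      simp only [neg_add]
  -- assemble: four Mecke identities, matched pairwise
  obtain ⟨hΦp, hΨp⟩ := hside w hK
  obtain ⟨hΦm, hΨm⟩ := hside (-w) hKm
  rw [lintegral_add_measure, lintegral_add_measure, hΦp, hΨp, hΦm, hΨm]
  simp only [neg_neg]
  abel

end Doubling

end Summit.AtomisticToContinuum.Crystallization.Theorems.FrustratedLawDichotomyFiniteClusterGap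

end
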